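import Literature.Analysis.FunctionSpaces.ItoProcesses
import Literature.Probability.Process.ItoFormulaCore
import Literature.Probability.Process.KolmogorovChentsov
import HarnessLib

/-!
# Itô's formula for Itô processes: discharge of `Literature.Analysis.FunctionSpaces.ito_formula_itoProcess_ae`

Sibling proof file of `Literature/Analysis/FunctionSpaces/ItoProcesses.lean` (the other sibling,
`ItoProcessesProofs.lean`, concerns Lipschitz SDEs). It proves (without `sorry`) the named fact
`Literature.Analysis.FunctionSpaces.ito_formula_itoProcess_ae` of that file — Itô's formula for Itô processes
`X = X₀ + ∫ b ds + ∫ σ dB` driven by the canonical Brownian motion, in integrated form, for the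
raw Brownian filtration — and hence reduces the corrected fact
`Literature.Analysis.FunctionSpaces.ito_formula_itoProcess_of_progressive` to the existence fact `Literature.Probability.Process.exists_isItoIntegral`
alone (`Literature.Analysis.FunctionSpaces.ito_formula_itoProcess_of_progressive_of_exists`).

The proof is the Taylor-expansion proof (Le Gall 2016, Thm 5.10), organised as follows:
* WLOG `X` is progressively measurable (replace it by its dyadic regularisation `dyadicReg X`,
  which has the same paths almost surely);
* at a fixed time `t`, the stochastic core (`ItoFormulaCore`: Riemann sums of `∂ₓf(·, X)` against
  `J = ∫ σ dB` converge to `K = ∫ σ ∂ₓf(·, X) dB`, quadratic sums of `J` over the cells starting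
  before `r` converge to `∫₀ʳ σ²`, both in probability along the refined grids) is turned into
  almost-sure convergence along a subsequence of grids by a diagonal selection and the
  Borel–Cantelli lemma;
* for almost every path the deterministic endgame `Literature.Probability.Process.ito_formula_path_of_tendsto`
  (`ItoFormulaPathwise`) gives the formula at time `t`;
* countably many times and continuity in `t` of both sides give the formula for all times.

## References

* J.-F. Le Gall, *Brownian Motion, Martingales, and Stochastic Calculus* (2016), Thm 5.10,
  Prop. 4.21, Prop. 5.9.
* D. Revuz, M. Yor, *Continuous Martingales and Brownian Motion* (3rd ed., 1999), Ch. IV,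
  Thm (3.3) and Remark 1°, Prop. (2.4), Prop. (2.13), Thm (2.12).
-/

open MeasureTheory ProbabilityTheory Filter Finset
open scoped NNReal ENNReal Topology

noncomputable section

namespace Literature.Analysis.FunctionSpaces

/-! ### Calculus of `f ∈ C²(ℝ × ℝ)` in the one-variable `deriv` form -/

section Calculus

variable {f : ℝ → ℝ → ℝ}

/-- For `f ∈ C¹(ℝ × ℝ)`, each section `f(s, ·)` has derivative `deriv (f s)`. [folklore] -/
theorem hasDerivAt_apply_right (hf : ContDiff ℝ 1 (Function.uncurry f)) (s y : ℝ) :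
    HasDerivAt (f s) (deriv (f s) y) y := by
  have hd : DifferentiableAt ℝ (f s) y :=
    ((hf.differentiable one_ne_zero).comp (differentiable_const s |>.prodMk differentiable_id)) y
  exact hd.hasDerivAt

/-- For `f ∈ C¹(ℝ × ℝ)`, each section `f(·, y)` has derivative `deriv (f · y)`. [folklore] -/
theorem hasDerivAt_apply_left (hf : ContDiff ℝ 1 (Function.uncurry f)) (s y : ℝ) :
    HasDerivAt (fun r ↦ f r y) (deriv (fun r ↦ f r y) s) s := by
  have hd : DifferentiableAt ℝ (fun r ↦ f r y) s :=
    ((hf.differentiable one_ne_zero).comp (differentiable_id.prodMk (differentiable_const y))) s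
  exact hd.hasDerivAt

/-- For `f ∈ C²(ℝ × ℝ)`, `deriv (f s)` has derivative `iteratedDeriv 2 (f s)`. [folklore] -/
theorem hasDerivAt_deriv_apply_right (hf : ContDiff ℝ 2 (Function.uncurry f)) (s y : ℝ) :
    HasDerivAt (deriv (f s)) (iteratedDeriv 2 (f s) y) y := by
  have hfs : ContDiff ℝ 2 (f s) := hf.comp (contDiff_prodMk_right s)
  have hd : Differentiable ℝ (iteratedDeriv 1 (f s)) :=
    hfs.differentiable_iteratedDeriv 1 (by norm_cast)
  rw [iteratedDeriv_one] at hd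
  rw [iteratedDeriv_succ, iteratedDeriv_one]
  exact (hd y).hasDerivAt

end Calculus

/-! ### The formula at a fixed time, for a progressively measurable `X` -/

section FixedTime

variable {f : ℝ → ℝ → ℝ} {X b σ K : ℝ≥0 → (ℝ≥0 → ℝ) → ℝ}

/-- From summable bad-event probabilities to "almost surely, eventually good". [folklore] -/
theorem ae_eventually_notMem_of_measure_le_pow {Ω : Type*} {mΩ : MeasurableSpace Ω} {P : Measure Ω}
    {S : ℕ → Set Ω} (hS : ∀ j, P (S j) ≤ (2⁻¹ : ℝ≥0∞) ^ j) :
    ∀ᵐ ω ∂P, ∃ J : ℕ, ∀ j ≥ J, ω ∉ S j := by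
  have hsum : ∑' j, P (S j) ≠ ∞ := by
    refine ne_top_of_le_ne_top ?_ (ENNReal.tsum_le_tsum hS)
    rw [ENNReal.tsum_geometric, ENNReal.one_sub_inv_two, inv_inv]
    exact ENNReal.ofNat_ne_top
  have h0 := (measure_eq_zero_iff_ae_notMem (μ := P)).1 (measure_limsup_atTop_eq_zero hsum)
  filter_upwards [h0] with ω hω
  rw [Filter.limsup_eq_iInf_iSup_of_nat] at hω
  simp only [Set.iInf_eq_iInter, Set.iSup_eq_iUnion, Set.mem_iInter, Set.mem_iUnion, not_forall,
    not_exists, exists_prop] at hω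
  obtain ⟨J, hJ⟩ := hω
  exact ⟨J, fun j hj hmem ↦ hJ j ⟨hj, hmem⟩⟩

/-- A real sequence trapped within `1/(j+1)` of a point eventually converges to it. [folklore] -/
theorem tendsto_of_forall_abs_sub_lt {a : ℕ → ℝ} {A : ℝ} {J : ℕ}
    (h : ∀ j ≥ J, |a j - A| < 1 / ((j : ℝ) + 1)) : Tendsto a atTop (𝓝 A) := by
  rw [Metric.tendsto_atTop]
  intro ε hε
  obtain ⟨N, hN⟩ := exists_nat_gt (1 / ε)
  refine ⟨max J N, fun j hj ↦ ?_⟩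
  rw [Real.dist_eq]
  refine (h j ((le_max_left _ _).trans hj)).trans_le ?_
  rw [div_le_iff₀ (by positivity)]
  have hjN : (N : ℝ) ≤ j := by exact_mod_cast (le_max_right _ _).trans hj
  rw [div_lt_iff₀ hε] at hN
  nlinarith

/-- **Itô's formula at a fixed time for a progressively measurable Itô process** (the heart of the
discharge of `ito_formula_itoProcess_ae`): almost surely,
`f(t, X_t) = f(0, X_0) + ∫₀ᵗ (∂ₜf + b ∂ₓf + ½ σ² ∂ₓₓf)(s, X_s) ds + K_t`.
Stochastic core (`ItoFormulaCore`) + diagonal selection and Borel–Cantelli + the pathwise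
endgame `ito_formula_path_of_tendsto`.
Le Gall (2016), Thm 5.10; Revuz–Yor (1999), Ch. IV, Thm (3.3) and Remark 1°. [folklore] -/
theorem ito_formula_itoProcess_ae_at (hf : ContDiff ℝ 2 (Function.uncurry f))
    (hXa : Adapted Literature.Probability.RandomPlanarGeometry.brownianFiltration X) (hXp : IsStronglyProgressive Literature.Probability.RandomPlanarGeometry.brownianFiltration X)
    (hσp : IsStronglyProgressive Literature.Probability.RandomPlanarGeometry.brownianFiltration σ)
    (hX : IsItoProcess X b σ Literature.Probability.Process.brownian Literature.Probability.RandomPlanarGeometry.brownianFiltration Literature.Probability.Process.preWienerMeasure)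
    (hK : Literature.Probability.Process.IsItoIntegral (fun t ω ↦ σ t ω * deriv (f t) (X t ω)) Literature.Probability.Process.brownian K Literature.Probability.RandomPlanarGeometry.brownianFiltration
      Literature.Probability.Process.preWienerMeasure) (t : ℝ≥0) :
    ∀ᵐ ω ∂Literature.Probability.Process.preWienerMeasure,
      f t (X t ω) = f (0 : ℝ≥0) (X 0 ω) +
        (∫ s in (0 : ℝ)..t, (deriv (fun r ↦ f r (X s.toNNReal ω)) (s.toNNReal : ℝ) +
          b s.toNNReal ω * deriv (f (s.toNNReal : ℝ)) (X s.toNNReal ω) +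
          2⁻¹ * σ s.toNNReal ω ^ 2 * iteratedDeriv 2 (f (s.toNNReal : ℝ)) (X s.toNNReal ω))) +
        K t ω := by
  haveI := Literature.Probability.RandomPlanarGeometry.isProbabilityMeasure_preWienerMeasure'
  have hf1 : ContDiff ℝ 1 (Function.uncurry f) := hf.of_le one_le_two
  -- Step 0: the data
  obtain ⟨hb, J, hJ, hdec⟩ := hX
  obtain ⟨H, hH⟩ := hJ.2.2.2.1
  have hHJ : Literature.Probability.Process.TendstoUCP (fun n ↦ (H n).integral Literature.Probability.Process.brownian) J Literature.Probability.Process.preWienerMeasure := hJ.2.2.2.2 H hH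
  have hJc : ∀ᵐ ω ∂Literature.Probability.Process.preWienerMeasure, Continuous (J · ω) := hJ.2.1
  have hσj : Measurable fun p : (ℝ≥0 → ℝ) × ℝ ↦ σ p.2.toNNReal p.1 :=
    Literature.Probability.Process.measurable_uncurry_of_isStronglyProgressive hσp
  have hXj : Measurable fun p : (ℝ≥0 → ℝ) × ℝ ↦ X p.2.toNNReal p.1 :=
    Literature.Probability.Process.measurable_uncurry_of_isStronglyProgressive hXp
  have hfin := ae_lintegral_sq_lt_top_of_isApproxSeq hH
  have hσint := ae_integrableOn_sq_of_isApproxSeq hH (fun ω ↦ hσj.comp measurable_prodMk_left)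
  have hXc : ∀ᵐ ω ∂Literature.Probability.Process.preWienerMeasure, Continuous (X · ω) :=
    IsItoProcess.ae_continuous ⟨hb, J, hJ, hdec⟩
  -- the integrand `Z = ∂ₓf(·, X)`
  set Z : ℝ≥0 → (ℝ≥0 → ℝ) → ℝ := fun s ω ↦ deriv (f s) (X s ω) with hZ
  have hZa : Adapted Literature.Probability.RandomPlanarGeometry.brownianFiltration Z := adapted_deriv_apply hf1 hXa
  have hZj : Measurable fun p : (ℝ≥0 → ℝ) × ℝ ↦ Z p.2.toNNReal p.1 :=
    (continuous_deriv_apply_right hf1).measurable.comp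
      ((measurable_coe_nnreal_real.comp (measurable_real_toNNReal.comp measurable_snd)).prodMk hXj)
  have hZc : ∀ᵐ ω ∂Literature.Probability.Process.preWienerMeasure, Continuous (Z · ω) :=
    IsItoProcess.ae_continuous_deriv_apply hf1 ⟨hb, J, hJ, hdec⟩
  have hK' : Literature.Probability.Process.IsItoIntegral (fun s ω ↦ σ s ω * Z s ω) Literature.Probability.Process.brownian K Literature.Probability.RandomPlanarGeometry.brownianFiltration Literature.Probability.Process.preWienerMeasure := hK
  -- Step 1: the stochastic core
  have core1 := fun (C : ℕ) (j : ℕ) (M : ℕ) (hM : 0 < M) ↦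
    Literature.Probability.Process.exists_forall_measure_riemannSum_sub_ge_le (K := K) hσj hH hHJ hfin hZj hZa hZc hK' t
      (Nat.cast_nonneg C) (η := 1 / ((j : ℝ) + 1)) (by positivity)
      (ε := (1 / 2 : ℝ) ^ j / M) (by positivity)
  -- coarse points, indexed by pairs `(n₀, l)`
  set rp : ℕ × ℕ → ℝ≥0 := fun p ↦ t * ((min p.2 (2 ^ p.1) : ℕ) : ℝ≥0) / 2 ^ p.1 with hrp
  have hrp_le : ∀ p, rp p ≤ t := fun p ↦ Literature.Probability.Process.uniformGrid_le t p.1 (min_le_right _ _)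
  have core2 := fun (p : ℕ × ℕ) (j : ℕ) (M : ℕ) (hM : 0 < M) ↦
    Literature.Probability.Process.exists_forall_measure_quadSum_sub_ge_le (J := J) hσj hH hHJ hfin t (hrp_le p)
      (η := 1 / ((j : ℝ) + 1)) (by positivity) (ε := (1 / 2 : ℝ) ^ j / M) (by positivity)
  -- Step 2: the selection
  set pairs : ℕ → Finset (ℕ × ℕ) := fun j ↦ (range (j + 1)) ×ˢ (range (2 ^ j + 1)) with hpairs
  set M : ℕ → ℕ := fun j ↦ (j + 1) + (pairs j).card with hM
  have hMpos : ∀ j, 0 < M j := fun j ↦ by positivity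
  choose N1 hN1 using fun C j ↦ core1 C j (M j) (hMpos j)
  choose K2 N2 hKN2 using fun p j ↦ core2 p j (M j) (hMpos j)
  set kj : ℕ → ℕ := fun j ↦ (pairs j).sup fun p ↦ K2 p j with hkj
  set nj : ℕ → ℕ := fun j ↦ max j (max ((range (j + 1)).sup fun C ↦ N1 C j)
    ((pairs j).sup fun p ↦ N2 p j (kj j))) with hnj
  have hnj_ge : ∀ j, j ≤ nj j := fun j ↦ le_max_left _ _
  have hnj_ge1 : ∀ j, ∀ C ≤ j, N1 C j ≤ nj j := fun j C hC ↦
    (Finset.le_sup (f := fun C ↦ N1 C j) (mem_range.2 (Nat.lt_succ_of_le hC))).trans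
      ((le_max_left _ _).trans (le_max_right _ _))
  have hkj_ge : ∀ j, ∀ p ∈ pairs j, K2 p j ≤ kj j := fun j p hp ↦
    Finset.le_sup (f := fun p ↦ K2 p j) hp
  have hnj_ge2 : ∀ j, ∀ p ∈ pairs j, N2 p j (kj j) ≤ nj j := fun j p hp ↦
    (Finset.le_sup (f := fun p ↦ N2 p j (kj j)) hp).trans ((le_max_right _ _).trans (le_max_right _ _))
  -- the grids along the selection
  set R : ℕ → Literature.Probability.Process.SimpleProcess (inferInstance : MeasurableSpace (ℝ≥0 → ℝ)) Literature.Probability.RandomPlanarGeometry.brownianFiltration :=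
    fun j ↦ (H (kj j)).gridRefine t (nj j) with hR
  set Γ : ℕ → ℕ → Literature.Probability.Process.SimpleProcess (inferInstance : MeasurableSpace (ℝ≥0 → ℝ)) Literature.Probability.RandomPlanarGeometry.brownianFiltration :=
    fun C j ↦ Literature.Probability.Process.SimpleProcess.sampleOn Z hZa ((H (kj j)).gridTimes t (nj j))
      ((H (kj j)).sortedLT_gridTimes t (nj j)) C with hΓ
  -- the bad events
  set B1 : ℕ → ℕ → Set (ℝ≥0 → ℝ) := fun C j ↦
    {ω | 1 / ((j : ℝ) + 1) ≤ |(Γ C j).integral J t ω - K t ω|} ∩ {ω | ∀ s ≤ t, |Z s ω| ≤ C} with hB1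
  set B2 : ℕ × ℕ → ℕ → Set (ℝ≥0 → ℝ) := fun p j ↦
    {ω | 1 / ((j : ℝ) + 1) ≤ |∑ i ∈ range ((R j).times.length - 1),
      (Set.Iio (rp p)).indicator (1 : ℝ≥0 → ℝ) (min t ((R j).time i)) *
        (J (min t ((R j).time (i + 1))) ω - J (min t ((R j).time i)) ω) ^ 2 -
      ∫ s in (0 : ℝ)..(rp p : ℝ), σ s.toNNReal ω ^ 2|} with hB2
  set S : ℕ → Set (ℝ≥0 → ℝ) := fun j ↦ (⋃ C ∈ range (j + 1), B1 C j) ∪ (⋃ p ∈ pairs j, B2 p j) with hS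
  have hPS : ∀ j, Literature.Probability.Process.preWienerMeasure (S j) ≤ (2⁻¹ : ℝ≥0∞) ^ j := by
    intro j
    have h1 : ∀ C ∈ range (j + 1), Literature.Probability.Process.preWienerMeasure (B1 C j) ≤ ENNReal.ofReal ((1 / 2 : ℝ) ^ j / M j) := by
      intro C hC
      exact hN1 C j (nj j) (hnj_ge1 j C (Nat.lt_succ_iff.1 (mem_range.1 hC))) (kj j)
    have h2 : ∀ p ∈ pairs j, Literature.Probability.Process.preWienerMeasure (B2 p j) ≤ ENNReal.ofReal ((1 / 2 : ℝ) ^ j / M j) := by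
      intro p hp
      exact hKN2 p j (kj j) (hkj_ge j p hp) (nj j) (hnj_ge2 j p hp)
    calc Literature.Probability.Process.preWienerMeasure (S j)
        ≤ Literature.Probability.Process.preWienerMeasure (⋃ C ∈ range (j + 1), B1 C j) + Literature.Probability.Process.preWienerMeasure (⋃ p ∈ pairs j, B2 p j) :=
          measure_union_le _ _
      _ ≤ ∑ C ∈ range (j + 1), Literature.Probability.Process.preWienerMeasure (B1 C j) + ∑ p ∈ pairs j, Literature.Probability.Process.preWienerMeasure (B2 p j) :=
          add_le_add (measure_biUnion_finset_le _ _) (measure_biUnion_finset_le _ _)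
      _ ≤ ∑ C ∈ range (j + 1), ENNReal.ofReal ((1 / 2 : ℝ) ^ j / M j) +
          ∑ p ∈ pairs j, ENNReal.ofReal ((1 / 2 : ℝ) ^ j / M j) :=
          add_le_add (sum_le_sum h1) (sum_le_sum h2)
      _ = (M j : ℝ≥0∞) * ENNReal.ofReal ((1 / 2 : ℝ) ^ j / M j) := by
          rw [sum_const, sum_const, card_range, nsmul_eq_mul, nsmul_eq_mul, ← add_mul]
          congr 1
          simp [hM]
      _ = (2⁻¹ : ℝ≥0∞) ^ j := by
          rw [← ENNReal.ofReal_natCast, ← ENNReal.ofReal_mul (Nat.cast_nonneg _),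
            mul_div_cancel₀ _ (by exact_mod_cast (hMpos j).ne'), ENNReal.ofReal_pow (by norm_num),
            ENNReal.ofReal_div_of_pos two_pos, ENNReal.ofReal_one, one_div, ENNReal.ofReal_ofNat]
  have hgood := ae_eventually_notMem_of_measure_le_pow hPS
  -- Step 3: the pathwise endgame
  filter_upwards [hgood, hXc, hJc, hZc, hb, hdec, hσint] with ω hωgood hωX hωJ hωZ hωb hωdec hωσ
  obtain ⟨J₀, hJ₀⟩ := hωgood
  -- grids for the endgame
  set v : ℕ → ℕ → ℝ≥0 := fun j i ↦ min t ((R j).time i) with hv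
  set Nc : ℕ → ℕ := fun j ↦ (R j).times.length - 1 with hNc
  have hvt : ∀ j, ∀ i ≤ Nc j, v j i ≤ t := fun j i _ ↦ min_le_left _ _
  have hvmono : ∀ j, ∀ i < Nc j, v j i ≤ v j (i + 1) := fun j i hi ↦
    min_le_min_left _ ((R j).time_mono (Nat.le_succ i) (Nat.add_lt_of_lt_sub hi))
  have hv0 : ∀ j, v j 0 = 0 := fun j ↦ by
    simp only [hv, hR, (H (kj j)).gridRefine_time_zero]; simp
  have hvN : ∀ j, v j (Nc j) = t := fun j ↦
    min_eq_left ((H (kj j)).le_gridRefine_time_length_sub_one t (nj j))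
  set δ : ℕ → ℝ := fun j ↦ (t : ℝ) / 2 ^ (nj j) with hδ
  have hδlim : Tendsto δ atTop (𝓝 0) := by
    have h0 : Tendsto (fun n : ℕ ↦ (t : ℝ) / 2 ^ n) atTop (𝓝 0) := by
      have := (tendsto_pow_atTop_nhds_zero_of_lt_one (r := (1 / 2 : ℝ)) (by norm_num) (by norm_num)).const_mul (t : ℝ)
      rw [mul_zero] at this
      refine this.congr fun n ↦ ?_
      rw [one_div, inv_pow, div_eq_mul_inv]
    exact h0.comp (tendsto_atTop_atTop.2 fun b ↦ ⟨b, fun a ha ↦ ha.trans (hnj_ge a)⟩)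
  have hmesh : ∀ j, ∀ i < Nc j, (v j (i + 1) : ℝ) - v j i ≤ δ j := fun j i hi ↦
    (H (kj j)).gridRefine_cappedCell_le t (nj j) (Nat.add_lt_of_lt_sub hi)
  -- (a) the Riemann sums
  obtain ⟨Csup, hCsup⟩ := Literature.Probability.Process.exists_forall_abs_le_of_continuous hωZ t
  set C : ℕ := ⌈Csup⌉₊ with hC
  have hgoodC : ∀ s ≤ t, |Z s ω| ≤ (C : ℝ) := fun s hs ↦ (hCsup s hs).trans (Nat.le_ceil _)
  have hRS : Tendsto (fun j ↦ ∑ i ∈ range (Nc j),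
      deriv (f (v j i)) (X (v j i) ω) * (J (v j (i + 1)) ω - J (v j i) ω)) atTop (𝓝 (K t ω)) := by
    -- the clamped Riemann sums converge, and agree with these
    have hlim : Tendsto (fun j ↦ (Γ C j).integral J t ω) atTop (𝓝 (K t ω)) := by
      refine tendsto_of_forall_abs_sub_lt (J := max J₀ C) fun j hj ↦ ?_
      have hjJ : J₀ ≤ j := (le_max_left _ _).trans hj
      have hjC : C ≤ j := (le_max_right _ _).trans hj
      have hnot := hJ₀ j hjJ
      simp only [hS, Set.mem_union, Set.mem_iUnion, not_or, not_exists] at hnot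
      have h1 := hnot.1 C (mem_range.2 (Nat.lt_succ_of_le hjC))
      simp only [hB1, Set.mem_inter_iff, Set.mem_setOf_eq, not_and] at h1
      exact not_le.1 fun hA ↦ h1 hA hgoodC
    refine hlim.congr fun j ↦ ?_
    rw [Literature.Probability.Process.SimpleProcess.integral_sampleOn]
    refine sum_congr rfl fun i hi ↦ ?_
    have hi' : i + 1 < (R j).times.length := Nat.add_lt_of_lt_sub (mem_range.1 hi)
    have htime : ∀ i, (Γ C j).time i = (R j).time i := fun i ↦ rfl
    rw [htime, htime]
    by_cases hit : (R j).time i ≤ t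
    · have hvi : v j i = (R j).time i := min_eq_right hit
      rw [Literature.Probability.Process.clamp_eq_self (hgoodC _ hit), hvi, min_eq_right hit]
    · push Not at hit
      have hvi : v j i = t := min_eq_left hit.le
      have hvi1 : v j (i + 1) = t := min_eq_left (hit.le.trans ((R j).time_mono (Nat.le_succ i) hi'))
      have hm1 : min t ((R j).time (i + 1)) = t :=
        min_eq_left (hit.le.trans ((R j).time_mono (Nat.le_succ i) hi'))
      have hm0 : min t ((R j).time i) = t := min_eq_left hit.le
      rw [hvi, hvi1, hm1, hm0, sub_self, mul_zero, mul_zero]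
  -- (b) the quadratic sums over the cells starting before the coarse points
  have hQS : ∀ n₀ l : ℕ, l ≤ 2 ^ n₀ → Tendsto (fun j ↦ ∑ i ∈ range (Nc j),
      (Set.Iio (t * (l : ℝ≥0) / 2 ^ n₀)).indicator (1 : ℝ≥0 → ℝ) (v j i) *
        (J (v j (i + 1)) ω - J (v j i) ω) ^ 2) atTop
      (𝓝 (∫ s in (0 : ℝ)..((t * (l : ℝ≥0) / 2 ^ n₀ : ℝ≥0) : ℝ), σ s.toNNReal ω ^ 2)) := by
    intro n₀ l hl
    have hrpl : rp (n₀, l) = t * (l : ℝ≥0) / 2 ^ n₀ := by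
      simp only [hrp, min_eq_left hl]
    refine tendsto_of_forall_abs_sub_lt (J := max J₀ n₀) fun j hj ↦ ?_
    have hjJ : J₀ ≤ j := (le_max_left _ _).trans hj
    have hjn : n₀ ≤ j := (le_max_right _ _).trans hj
    have hmem : (n₀, l) ∈ pairs j := by
      simp only [hpairs, mem_product, Finset.mem_range]
      exact ⟨Nat.lt_succ_of_le hjn, Nat.lt_succ_of_le (hl.trans (Nat.pow_le_pow_right two_pos hjn))⟩
    have hnot := hJ₀ j hjJ
    simp only [hS, Set.mem_union, Set.mem_iUnion, not_or, not_exists] at hnot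
    have h2 := hnot.2 (n₀, l) hmem
    simp only [hB2, Set.mem_setOf_eq, not_le, hrpl] at h2
    exact h2
  -- (c) the deterministic endgame
  have key := Literature.Probability.Process.ito_formula_path_of_tendsto (t := t) (v := v) (N := Nc)
    (f := f) (g := fun s y ↦ deriv (f s) y) (h := fun s y ↦ iteratedDeriv 2 (f s) y)
    (k := fun s y ↦ deriv (fun r ↦ f r y) s)
    (fun s y ↦ hasDerivAt_apply_right hf1 s y) (fun s y ↦ hasDerivAt_deriv_apply_right hf s y)
    (fun s y ↦ hasDerivAt_apply_left hf1 s y)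
    (continuous_deriv_apply_right hf1) (continuous_iteratedDeriv_two_apply_right hf)
    (continuous_deriv_apply_left hf1)
    (x := fun s ↦ X s ω) (V := fun s ↦ ∫ r in (0 : ℝ)..(s : ℝ≥0), b r.toNNReal ω) (J := fun s ↦ J s ω)
    (b := fun s ↦ b s.toNNReal ω) (q := fun s ↦ σ s.toNNReal ω ^ 2) hωX hωJ (hωb t) (hωσ t)
    (fun s ↦ rfl) (fun s _ ↦ by rw [hωdec s]) hvt hvmono hv0 hvN hδlim hmesh hRS hQS
  -- (d) identify the integrands (time read through `s⁺` on `[0, t]`)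
  have hcongr : (∫ s in (0 : ℝ)..t, (deriv (fun r ↦ f r (X s.toNNReal ω)) (s.toNNReal : ℝ) +
        b s.toNNReal ω * deriv (f (s.toNNReal : ℝ)) (X s.toNNReal ω) +
        2⁻¹ * σ s.toNNReal ω ^ 2 * iteratedDeriv 2 (f (s.toNNReal : ℝ)) (X s.toNNReal ω))) =
      ∫ s in (0 : ℝ)..t, (deriv (fun r ↦ f r (X s.toNNReal ω)) s +
        b s.toNNReal ω * deriv (f (s.toNNReal : ℝ)) (X s.toNNReal ω) +
        2⁻¹ * σ s.toNNReal ω ^ 2 * iteratedDeriv 2 (f (s.toNNReal : ℝ)) (X s.toNNReal ω)) := by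
    refine intervalIntegral.integral_congr fun s hs ↦ ?_
    rw [Set.uIcc_of_le (NNReal.coe_nonneg t)] at hs
    simp only [Real.coe_toNNReal _ hs.1]
  rw [hcongr]
  simpa using key

end FixedTime

/-! ### All times simultaneously, and removal of the progressivity assumption on `X` -/

section AllTimes

variable {f : ℝ → ℝ → ℝ} {X b σ K : ℝ≥0 → (ℝ≥0 → ℝ) → ℝ}

open Literature.Probability.Process.KolmogorovChentsov in
/-- **Itô's formula for a progressively measurable Itô process, all times a.s.**: the fixed-time
statement at every dyadic time (countably many), and continuity in `t` of both sides.
Le Gall (2016), Thm 5.10; Revuz–Yor (1999), Ch. IV, Thm (3.3). [folklore] -/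
theorem ito_formula_itoProcess_ae_of_isStronglyProgressive (hf : ContDiff ℝ 2 (Function.uncurry f))
    (hXa : Adapted Literature.Probability.RandomPlanarGeometry.brownianFiltration X) (hXp : IsStronglyProgressive Literature.Probability.RandomPlanarGeometry.brownianFiltration X)
    (hσp : IsStronglyProgressive Literature.Probability.RandomPlanarGeometry.brownianFiltration σ)
    (hX : IsItoProcess X b σ Literature.Probability.Process.brownian Literature.Probability.RandomPlanarGeometry.brownianFiltration Literature.Probability.Process.preWienerMeasure)
    (hK : Literature.Probability.Process.IsItoIntegral (fun t ω ↦ σ t ω * deriv (f t) (X t ω)) Literature.Probability.Process.brownian K Literature.Probability.RandomPlanarGeometry.brownianFiltration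
      Literature.Probability.Process.preWienerMeasure) :
    ∀ᵐ ω ∂Literature.Probability.Process.preWienerMeasure, ∀ t : ℝ≥0,
      f t (X t ω) = f (0 : ℝ≥0) (X 0 ω) +
        (∫ s in (0 : ℝ)..t, (deriv (fun r ↦ f r (X s.toNNReal ω)) (s.toNNReal : ℝ) +
          b s.toNNReal ω * deriv (f (s.toNNReal : ℝ)) (X s.toNNReal ω) +
          2⁻¹ * σ s.toNNReal ω ^ 2 * iteratedDeriv 2 (f (s.toNNReal : ℝ)) (X s.toNNReal ω))) +
        K t ω := by
  have hdyad := ae_all_iff.2 fun mk : ℕ × ℕ ↦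
    ito_formula_itoProcess_ae_at hf hXa hXp hσp hX hK (dyad mk.1 mk.2)
  have hXc := hX.ae_continuous
  have hKc := hK.2.1
  have hD := hX.ae_integrableOn_itoDrift hf hσp
  filter_upwards [hdyad, hXc, hKc, hD] with ω hω hωX hωK hωD
  -- both sides are continuous in `t`
  set D : ℝ → ℝ := fun s ↦ deriv (fun r ↦ f r (X s.toNNReal ω)) (s.toNNReal : ℝ) +
    b s.toNNReal ω * deriv (f (s.toNNReal : ℝ)) (X s.toNNReal ω) +
    2⁻¹ * σ s.toNNReal ω ^ 2 * iteratedDeriv 2 (f (s.toNNReal : ℝ)) (X s.toNNReal ω) with hDdef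
  have hDint : ∀ a c : ℝ, IntervalIntegrable D volume a c :=
    intervalIntegrable_of_forall_integrableOn_Icc (fun s hs ↦ by
      simp only [hDdef, Real.toNNReal_of_nonpos hs, Real.toNNReal_zero]) hωD
  have hL : Continuous fun t : ℝ≥0 ↦ f t (X t ω) :=
    hf.continuous.comp (NNReal.continuous_coe.prodMk hωX)
  have hR : Continuous fun t : ℝ≥0 ↦ f (0 : ℝ≥0) (X 0 ω) + (∫ s in (0 : ℝ)..t, D s) + K t ω :=
    (continuous_const.add ((intervalIntegral.continuous_primitive hDint 0).comp
      NNReal.continuous_coe)).add hωK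
  have heq := Continuous.ext_on dense_dyadics hL hR fun x hx ↦ by
    obtain ⟨mk1, mk2, rfl⟩ := hx
    exact hω (mk1, mk2)
  intro t
  exact congrFun heq t

/-- **Itô's formula for Itô processes, integrated form** (the content of
`ito_formula_itoProcess_ae`): the progressivity assumption on `X` of
`ito_formula_itoProcess_ae_of_isStronglyProgressive` is removed by passing to the dyadic
regularisation `dyadicReg X`, which is progressively measurable and has the same paths almost
surely (`X` has a.s. continuous paths).
Le Gall (2016), Thm 5.10; Revuz–Yor (1999), Ch. IV, Thm (3.3) and Remark 1°. [folklore] -/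
theorem ito_formula_itoProcess_ae_of (hf : ContDiff ℝ 2 (Function.uncurry f))
    (hXa : Adapted Literature.Probability.RandomPlanarGeometry.brownianFiltration X) (hσp : IsStronglyProgressive Literature.Probability.RandomPlanarGeometry.brownianFiltration σ)
    (hX : IsItoProcess X b σ Literature.Probability.Process.brownian Literature.Probability.RandomPlanarGeometry.brownianFiltration Literature.Probability.Process.preWienerMeasure)
    (hK : Literature.Probability.Process.IsItoIntegral (fun t ω ↦ σ t ω * deriv (f t) (X t ω)) Literature.Probability.Process.brownian K Literature.Probability.RandomPlanarGeometry.brownianFiltration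
      Literature.Probability.Process.preWienerMeasure) :
    ∀ᵐ ω ∂Literature.Probability.Process.preWienerMeasure, ∀ t : ℝ≥0,
      f t (X t ω) = f (0 : ℝ≥0) (X 0 ω) +
        (∫ s in (0 : ℝ)..t, (deriv (fun r ↦ f r (X s.toNNReal ω)) (s.toNNReal : ℝ) +
          b s.toNNReal ω * deriv (f (s.toNNReal : ℝ)) (X s.toNNReal ω) +
          2⁻¹ * σ s.toNNReal ω ^ 2 * iteratedDeriv 2 (f (s.toNNReal : ℝ)) (X s.toNNReal ω))) +
        K t ω := by
  set X' := dyadicReg X with hX'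
  have hX'p : IsStronglyProgressive Literature.Probability.RandomPlanarGeometry.brownianFiltration X' := isStronglyProgressive_dyadicReg hXa
  have hX'a : Adapted Literature.Probability.RandomPlanarGeometry.brownianFiltration X' := hX'p.stronglyAdapted.adapted
  have hpath : ∀ᵐ ω ∂Literature.Probability.Process.preWienerMeasure, ∀ s, X' s ω = X s ω := by
    filter_upwards [hX.ae_continuous] with ω hω s
    exact dyadicReg_apply_of_continuous hω s
  obtain ⟨hb, J, hJ, hdec⟩ := hX
  have hX' : IsItoProcess X' b σ Literature.Probability.Process.brownian Literature.Probability.RandomPlanarGeometry.brownianFiltration Literature.Probability.Process.preWienerMeasure := by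
    refine ⟨hb, J, hJ, ?_⟩
    filter_upwards [hdec, hpath] with ω hω hω' s
    rw [hω', hω', hω s]
  have hK' : Literature.Probability.Process.IsItoIntegral (fun t ω ↦ σ t ω * deriv (f t) (X' t ω)) Literature.Probability.Process.brownian K Literature.Probability.RandomPlanarGeometry.brownianFiltration
      Literature.Probability.Process.preWienerMeasure := by
    refine hK.congr_integrand_ae ?_
    filter_upwards [hpath] with ω hω s
    rw [hω s]
  have h := ito_formula_itoProcess_ae_of_isStronglyProgressive hf hX'a hX'p hσp hX' hK'
  filter_upwards [h, hpath] with ω hω hω' t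
  have := hω t
  simp only [hω'] at this
  exact this

end AllTimes

/-! ### The named facts -/

/-- **Discharge of `Literature.Analysis.FunctionSpaces.ito_formula_itoProcess_ae`** (Itô's formula for Itô processes driven by
the canonical Brownian motion, integrated form, raw filtration): proved from the Itô-integral
machinery of `Literature.Probability.Process.*` (isometry and basic estimate for elementary
integrals, quadratic sums, products and sampled multipliers of simple processes) by the
Taylor-expansion proof of Le Gall, Thm 5.10, along a Borel–Cantelli subsequence of grids.
K. Itô (1951); Revuz–Yor, *Continuous Martingales and Brownian Motion* (1999), Ch. IV,
Thm (3.3) and Remark 1°; Le Gall (2016), Thm 5.10.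
[cite: RevuzYor1999, Ch. IV Thm (3.3) and Remark 1] -/
theorem ito_formula_itoProcess_ae_holds : ito_formula_itoProcess_ae :=
  fun _ _ _ _ _ hf hXa hσ hX hK ↦ ito_formula_itoProcess_ae_of hf hXa hσ hX hK

/-- **The corrected Itô formula `ito_formula_itoProcess_of_progressive` follows from the existence
of Itô integrals alone**: with `ito_formula_itoProcess_ae` now proved, the reduction
`ito_formula_itoProcess_of_progressive_of_facts` needs only `exists_isItoIntegral`.
Revuz–Yor, *Continuous Martingales and Brownian Motion* (1999), Ch. IV, Thm (3.3). [folklore] -/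
theorem ito_formula_itoProcess_of_progressive_of_exists (hex : Literature.Probability.Process.exists_isItoIntegral) :
    ito_formula_itoProcess_of_progressive :=
  ito_formula_itoProcess_of_progressive_of_facts hex ito_formula_itoProcess_ae_holds

end Literature.Analysis.FunctionSpaces
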